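import Summits.QuantumAdvantage.QuantumAdvantage.Theorems.SosSandwichPseudoBoundedAASymmetricCorner
import Summits.QuantumAdvantage.QuantumAdvantage.Theorems.SosSandwichPseudoBoundedAALevelKRungMarkov
import Literature.Computability.Complexity.FourierDegreeAlgebra
import Mathlib.Analysis.SpecialFunctions.Exponential
import HarnessLib

/-!
# Crux `PseudoBoundedAA` (stmt-QuantumAdvantage-15237) / `AAConj` (10748) — the SYMMETRIC CORNER with the SHARP
# exponent, part 1/2: the centred rescaled weight and V. A. Markov's bound for the rescaled symmetrisation

Preparation for `Theorems/SosSandwichPseudoBoundedAASymmetricCornerSharp.lean`, where the Aaronson–Ambainis conjecture on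
the symmetric corner (`Theorems/SosSandwichPseudoBoundedAASymmetricCorner.lean`: `∃ i, Var[p]²/d⁴ ≤ Inf_i[p]`) is sharpened
to the conjectured optimum `∃ i, Var[p]²/(64 d²) ≤ Inf_i[p]` (item (3) of the g5 repair census, "d⁴ → d²", done with
V. A. Markov's COEFFICIENT inequality and Bonami's lemma instead of Bernstein's inequality).

* §1 the CENTRED RESCALED WEIGHT `t(x) = (2|x| − n)/n = −(1/n) Σ_i χ_{{i}}(x)`: Walsh expansion
  (`centredWeight_eq_sum_walsh`), Fourier level `≤ 1` (`isLevelLE_centredWeight`), `E t² = 1/n`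
  (`boolAvg_centredWeight_sq`), and the Bonami moments **`E t^{2j} ≤ (2j−1)^j/n^j`** (`boolAvg_centredWeight_pow_le`,
  O'Donnell 2014 Thm 9.21 at degree `1`, tree `IsLevelLE.bonami_even_moment`).
* §2 the RESCALED univariate polynomial `Q = P ∘ (n/2)(X+1)` (`Q(s) = P(n(s+1)/2)`, `deg Q ≤ deg P`): if `deg P ≤ d` and
  `|P| ≤ 2` on `[0, n]` then **`|[s^j] Q| ≤ 2·(2d)^j/j!`** for `j ≥ 1` (`abs_coeff_rescale_le`: V. A. Markov, Rivlin 1974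
  Sect. 2.7 (2.44)–(2.45), tree `MarkovCoefficientInequality.abs_coeff_le_mul_max_abs_coeff_T`, and
  `|t_j^{(m)}| ≤ (2m)^j/j!`, tree `LevelKRungMarkov.max_abs_coeff_T_le`); `j^j ≤ 3^j·j!` (`Real.pow_div_factorial_le_exp`);
  the Cauchy–Schwarz weights `Σ_{i<d} 4^{-(i+1)} ≤ 1/3`.

Honest label: support lemmas; no registered stub, crux or summit is closed.  Sources: Rivlin 1974 Sect. 2.7;
O'Donnell 2014 §1.2–1.4, Thm 9.21, §2.3.
-/

-- D-0017: single-conjunct summit ⇒ the duplicate `QuantumAdvantage.QuantumAdvantage` is mandated.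
set_option linter.dupNamespace false

noncomputable section

open Finset
open Literature.Computability.QuantumComplexity
open Literature.Computability.Complexity.LowDegree (cubeFourierCoeff IsLevelLE isLevelLE_walsh)
open Literature.Probability.RandomGraphs.LowDegree (walsh sgn)
open Literature.Analysis.Approximation.MarkovCoefficientInequality (abs_coeff_le_mul_max_abs_coeff_T)
open Summit.QuantumAdvantage.QuantumAdvantage.Theorems.SosSandwich.LevelKRungMarkov
  (max_abs_coeff_T_le max_abs_coeff_T_nonneg)

namespace Summit.QuantumAdvantage.QuantumAdvantage.Theorems.SosSandwich.SymmetricCorner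

variable {N : ℕ}

/-! ### §1 The centred rescaled weight `t(x) = (2|x| − n)/n` -/

/-- Walsh expansion of the centred rescaled weight: `(2|x| − n)/n = Σ_i (−1/n)·χ_{{i}}(x)`
(`2·1[x_i] − 1 = −χ_{{i}}(x)`). [cite: ODonnell2014, §1.2] -/
theorem centredWeight_eq_sum_walsh (x : Fin N → Bool) :
    (2 * (((Finset.univ.filter fun k => x k = true).card : ℕ) : ℝ) - N) / N =
      ∑ i : Fin N, (-1 / (N : ℝ)) * walsh {i} x := by
  have hpt : ∀ i : Fin N, (2 * (if x i then (1 : ℝ) else 0) - 1) = -walsh {i} x := by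
    intro i
    rw [walsh, Finset.prod_singleton, sgn]
    cases x i <;> norm_num
  have hsum : (2 * (((Finset.univ.filter fun k => x k = true).card : ℕ) : ℝ) - N) =
      ∑ i : Fin N, -walsh {i} x := by
    rw [weight_eq_sum, Finset.mul_sum]
    have hN : (N : ℝ) = ∑ _i : Fin N, (1 : ℝ) := by simp
    rw [hN, ← Finset.sum_sub_distrib]
    exact Finset.sum_congr rfl fun i _ => hpt i
  rw [hsum, Finset.sum_div]
  exact Finset.sum_congr rfl fun i _ => by ring

/-- The centred rescaled weight has Fourier level `≤ 1`. [cite: ODonnell2014, §1.4] -/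
theorem isLevelLE_centredWeight :
    IsLevelLE 1 (fun x : Fin N → Bool =>
      (2 * (((Finset.univ.filter fun k => x k = true).card : ℕ) : ℝ) - N) / N) := by
  have h : (fun x : Fin N → Bool => (2 * (((Finset.univ.filter fun k => x k = true).card : ℕ) : ℝ) - N) / N) =
      fun x => ∑ i ∈ (Finset.univ : Finset (Fin N)), (-1 / (N : ℝ)) * walsh {i} x := by
    funext x; exact centredWeight_eq_sum_walsh x
  rw [h]
  exact Literature.Computability.Complexity.LowDegree.IsLevelLE.sum _ fun i _ =>
    (isLevelLE_walsh {i} (by simp)).const_mul _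

/-- `E_x t(x)² = 1/n` for the centred rescaled weight (`E(|x| − n/2)² = n/4`). [cite: ODonnell2014, §2.3] -/
theorem boolAvg_centredWeight_sq (hN : 0 < N) :
    boolAvg (fun x : Fin N → Bool =>
      ((2 * (((Finset.univ.filter fun k => x k = true).card : ℕ) : ℝ) - N) / N) ^ 2) = 1 / N := by
  have hN0 : (N : ℝ) ≠ 0 := by exact_mod_cast hN.ne'
  have hpt : ∀ x : Fin N → Bool,
      ((2 * (((Finset.univ.filter fun k => x k = true).card : ℕ) : ℝ) - N) / N) ^ 2 =
        4 / (N : ℝ) ^ 2 * ((((Finset.univ.filter fun k => x k = true).card : ℕ) : ℝ) - N / 2) ^ 2 := by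
    intro x
    field_simp
    ring
  have h := boolAvg_weight_sub_half_sq (N := N)
  unfold boolAvg at h ⊢
  simp_rw [hpt]
  rw [← Finset.mul_sum, mul_div_assoc, h]
  field_simp

/-- **Bonami moments of the centred rescaled weight**: `E_x t(x)^{2j} ≤ (2j − 1)^j / n^j` for `j ≥ 1`
(Bonami's lemma at Fourier degree `1` with `E t² = 1/n`). [cite: ODonnell2014, Thm. 9.21] -/
theorem boolAvg_centredWeight_pow_le (hN : 0 < N) {j : ℕ} (hj : 1 ≤ j) :
    boolAvg (fun x : Fin N → Bool =>
      ((2 * (((Finset.univ.filter fun k => x k = true).card : ℕ) : ℝ) - N) / N) ^ (2 * j)) ≤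
      (2 * j - 1 : ℝ) ^ j / (N : ℝ) ^ j := by
  have hB := (isLevelLE_centredWeight (N := N)).bonami_even_moment j hj
  have h2 := boolAvg_centredWeight_sq hN
  unfold boolAvg at h2 ⊢
  rw [h2, mul_one] at hB
  have e : ∀ x : Fin N → Bool,
      ((2 * (((Finset.univ.filter fun k => x k = true).card : ℕ) : ℝ) - N) / N) ^ (2 * j) =
        (((2 * (((Finset.univ.filter fun k => x k = true).card : ℕ) : ℝ) - N) / N) ^ 2) ^ j := by
    intro x; rw [pow_mul]
  simp_rw [e]
  calc (∑ x : Fin N → Bool, (((2 * (((Finset.univ.filter fun k => x k = true).card : ℕ) : ℝ) - N) / N) ^ 2) ^ j) /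
        2 ^ N ≤ (2 * j - 1 : ℝ) ^ j * (1 / (N : ℝ)) ^ j := hB
    _ = (2 * j - 1 : ℝ) ^ j / (N : ℝ) ^ j := by rw [one_div, inv_pow, div_eq_mul_inv]

/-! ### §2 The rescaled univariate polynomial `Q(t) = P(n(1+t)/2)` and V. A. Markov's coefficient bound -/

/-- Values of the rescaling: `Q(s) = P(n(s+1)/2)`. [folklore] -/
theorem eval_rescale (P : Polynomial ℝ) (c s : ℝ) :
    (P.comp (Polynomial.C c * (Polynomial.X + Polynomial.C 1))).eval s = P.eval (c * (s + 1)) := by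
  simp [Polynomial.eval_comp]

/-- Degree of the rescaling: `deg Q ≤ deg P`. [folklore] -/
theorem natDegree_rescale_le (P : Polynomial ℝ) (c : ℝ) :
    (P.comp (Polynomial.C c * (Polynomial.X + Polynomial.C 1))).natDegree ≤ P.natDegree := by
  refine (Polynomial.natDegree_comp_le).trans ?_
  have h1 : (Polynomial.C c * (Polynomial.X + Polynomial.C 1)).natDegree ≤ 1 :=
    (Polynomial.natDegree_C_mul_le _ _).trans (by rw [Polynomial.natDegree_X_add_C])
  calc P.natDegree * (Polynomial.C c * (Polynomial.X + Polynomial.C 1)).natDegree ≤ P.natDegree * 1 :=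
        Nat.mul_le_mul_left _ h1
    _ = P.natDegree := mul_one _

/-- `j^j ≤ 3^j · j!` (from `j^j/j! ≤ e^j`, Mathlib `Real.pow_div_factorial_le_exp`, and `e < 3`). [folklore] -/
theorem pow_self_le_three_pow_mul_factorial (j : ℕ) : (j : ℝ) ^ j ≤ 3 ^ j * (j.factorial : ℝ) := by
  have h := Real.pow_div_factorial_le_exp (j : ℝ) (Nat.cast_nonneg j) j
  have hfac : (0 : ℝ) < (j.factorial : ℝ) := by exact_mod_cast Nat.factorial_pos j
  rw [div_le_iff₀ hfac] at h
  have he : Real.exp (j : ℝ) ≤ 3 ^ j := by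
    rw [← mul_one (j : ℝ), Real.exp_nat_mul]
    exact pow_le_pow_left₀ (Real.exp_pos 1).le (le_of_lt (lt_trans Real.exp_one_lt_d9 (by norm_num))) j
  calc (j : ℝ) ^ j ≤ Real.exp j * j.factorial := h
    _ ≤ 3 ^ j * j.factorial := mul_le_mul_of_nonneg_right he hfac.le

/-- **V. A. Markov on the rescaled polynomial.** If `deg P ≤ d` and `|P| ≤ 2` on `[0, n]` (`n > 0`), then the `j`-th
power-basis coefficient of `Q = P ∘ (n/2)(X+1)` satisfies `|b_j| ≤ 2·(2d)^j/j!` for `j ≥ 1`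
(`|Q| ≤ 2` on `[-1,1]`; `|b_j| ≤ 2 max(|t_j^{(d)}|, |t_j^{(d-1)}|)` and `|t_j^{(m)}| ≤ (2m)^j/j!`).
[cite: Rivlin1974, Sect. 2.7 Remark 2 (2.44)-(2.45)] -/
theorem abs_coeff_rescale_le {d : ℕ} {P : Polynomial ℝ} (hP : P.natDegree ≤ d) (hN : 0 < N)
    (hb : ∀ y ∈ Set.Icc (0 : ℝ) N, |P.eval y| ≤ 2) {j : ℕ} (hj : 1 ≤ j) :
    |(P.comp (Polynomial.C ((N : ℝ) / 2) * (Polynomial.X + Polynomial.C 1))).coeff j| ≤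
      2 * ((2 * (d : ℝ)) ^ j / (j.factorial : ℝ)) := by
  have hN0 : (0 : ℝ) < (N : ℝ) := by exact_mod_cast hN
  have hQdeg : (P.comp (Polynomial.C ((N : ℝ) / 2) * (Polynomial.X + Polynomial.C 1))).natDegree ≤ d :=
    (natDegree_rescale_le P _).trans hP
  have hQb : ∀ s ∈ Set.Icc (-1 : ℝ) 1,
      |(P.comp (Polynomial.C ((N : ℝ) / 2) * (Polynomial.X + Polynomial.C 1))).eval s| ≤ 2 := by
    intro s hs
    rw [eval_rescale]
    refine hb _ ⟨?_, ?_⟩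
    · have : 0 ≤ s + 1 := by linarith [hs.1]
      positivity
    · have : s + 1 ≤ 2 := by linarith [hs.2]
      nlinarith
  have h := abs_coeff_le_mul_max_abs_coeff_T hQdeg hQb j
  exact h.trans (mul_le_mul_of_nonneg_left (max_abs_coeff_T_le d hj) (by norm_num))

/-! ### §2b The Cauchy–Schwarz weights -/

/-- The Cauchy–Schwarz weights: `Σ_{i<d} 4^{-(i+1)} = (1 − 4^{-d})/3 ≤ 1/3`. [folklore] -/
theorem sum_quarter_pow_succ_le (d : ℕ) : ∑ i ∈ Finset.range d, (((1 : ℝ) / 2) ^ (i + 1)) ^ 2 ≤ 1 / 3 := by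
  have h : ∀ d : ℕ, ∑ i ∈ Finset.range d, (((1 : ℝ) / 2) ^ (i + 1)) ^ 2 = (1 - (1 / 4 : ℝ) ^ d) / 3 := by
    intro d
    induction d with
    | zero => simp
    | succ d ih =>
      rw [Finset.sum_range_succ, ih]
      have e : (((1 : ℝ) / 2) ^ (d + 1)) ^ 2 = (1 / 4 : ℝ) ^ d * (1 / 4) := by
        rw [← pow_mul, mul_comm (d + 1) 2, pow_mul, pow_succ]; norm_num
      rw [e, pow_succ]; ring
  rw [h d]
  have : 0 ≤ (1 / 4 : ℝ) ^ d := by positivity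
  linarith

end Summit.QuantumAdvantage.QuantumAdvantage.Theorems.SosSandwich.SymmetricCorner

end
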